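import Literature.AlgebraicGeometry.GroupSchemes.BTGroupNilpotentPoints          -- ★ p844872: `TorsPts`, `specOver`, `IsPTorsionOfLawVia`, `IsPTorsionOfOLawVia`
import Literature.AlgebraicGeometry.GroupSchemes.BarsottiTateGroupTorsionLayers    -- ★ p844948: `BTGroup.transition`, `existsUnique_fac_transition`, `transition_succ_right`
import HarnessLib

/-!
# The dictionary `B ≅ F[p^∞]` from natural nilpotent coordinates and a law read through them
# ([Tate 1967] §2.2, Prop. 1 — assembly step of «connected one-dimensional BT groups are formal Lie groups»)

Topic `Literature/AlgebraicGeometry/GroupSchemes`; namespace `Literature.AlgebraicGeometry.GroupSchemes`.  THEOREMS ONLY (no definition,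
no named fact, no instance, no notation, no `sorry`).  Cell `hodgecm-mathlib`, P6 «MOD programme», sub-desk F0P6d, sub-line 2
`Cruxes/HLiu418/Lines/F0_P6d_ConnectedBTDictionary.lean`, letter (HL-D) `ConnectedDimOneIsOModuleLaw` — step **(P5) «DICTIONARY
ASSEMBLY»**, typed `F`-AGNOSTIC: given a BT group `B` over `Spec k` (height `H ≥ 1`, `p ≥ 2`) with a NATURAL COORDINATE SYSTEM
`c n R : (Spec R → B.G n over Spec k) ≃ {x ∈ R ∣ x^{p^{nH}} = 0}` (natural in `R`, compatible with `incl`; ★ `BTGroupConnectedDimOneCoordinates`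
for connected one-dimensional `B`) and ANY commutative one-dimensional law `F` over `k` through which the group structure of `B` is read
(`c (f * g) = F(c f, c g)`; ★ `GroupObjectLawsFromCoordinates` ff. produce such an `F`), the coordinates ARE comparison bijections
`e n R : (Spec R → B.G n) ≃ F[pⁿ](R) = {x ∈ Nil R ∣ [pⁿ]_F x = 0}` satisfying ★ `IsPTorsionOfLawVia F p B e` — and, with an action
`β` of `𝒪` on `B` read through `ρ : 𝒪 → End F`, ★ `IsPTorsionOfOLawVia`.  The one non-formal point is the SUBTYPE IDENTIFICATION
`{x ∣ x^{p^{nH}} = 0} = F[pⁿ](R)` inside the nilpotent elements of `R`: (⊆) `[pⁿ]_F (c f) = c (f^{pⁿ}) = c 1 = 0` since `B.G n` is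
killed by `pⁿ`; (⊇) a nilpotent `x` is the coordinate of a point `g` of a deep layer `B.G m`, `[pⁿ]_F x = 0` says `g^{pⁿ} = 1`, so `g`
factors through `B.G n = B.G m[pⁿ]` (★ `BTGroup.existsUnique_fac_transition`, [Tate1967] (2.1) «`i_{ν,μ}` identify `G_ν` with the kernel
of `p^ν` in all `G_{μ+ν}`») and `x` is a level-`n` coordinate.  HC_CM is proved only modulo the printed citations until rung 0 closes;
nothing here is about HC.

THE PRINT.  [Tate1967] §2.2, Prop. 1 and its proof: for a divisible commutative formal Lie group `Γ` over `R`, `Γ[p^∞] = (Γ[p^ν])` is a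
connected `p`-divisible group, and conversely a connected `p`-divisible group `G` arises this way, the points of `G_ν` with values in an
`R`-algebra being the nilpotent solutions of `[p^ν](x) = 0` in compatible coordinates.  [Messing1972] Ch. II (3.3.18) for a general base.

MAIN STATEMENTS (for `c`, `F` as above; the clauses `hlaw`, `hincl`, `hnat` are passed where used).  §1 `coord_one_eq_zero_of_law`
(`c 1 = 0`), `coord_comp_pow_id_eq` (`c (f ≫ [m]) = [m]_F (c f)`), `coord_pow_eq`, **`evalNilp_nsmulHom_coord_eq_zero`** (`[pⁿ]_F (c f) = 0`);
§2 **`coord_comp_transition_eq`** (`c m (f ≫ i_{n,m}) = c n f`); §3 `le_pow_mul_of_two_le`, **`exists_coord_eq_of_mem_torsPts`** (every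
`x ∈ F[pⁿ](R)` is a level-`n` coordinate), `pow_eq_zero_of_mem_torsPts`; §4 HEADS **`BTGroup.exists_isPTorsionOfLawVia_of_coordinates`** and
**`BTGroup.exists_isPTorsionOfOLawVia_of_coordinates`** (`∃ e, IsPTorsionOf(O)LawVia … e ∧ (e f).1 = (c f).1`).

## References
* [Tate1967] J. T. Tate, *p-divisible groups*, Proc. Conf. Local Fields (Driebergen, 1966), Springer (1967) — §2 (2.1), §2.2 Prop. 1.
* [Messing1972] W. Messing, *The Crystals Associated to Barsotti–Tate Groups*, LNM 264 (1972) — Ch. II, (3.3.18).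
-/

set_option autoImplicit false

-- Mathlib's `Over`/`Scheme` APIs are stated across semireducible wrappers (as in the ★ `GroupSchemes/*` files).
set_option backward.isDefEq.respectTransparency false

noncomputable section

universe u v

open AlgebraicGeometry CategoryTheory MonObj CartesianMonoidalCategory
open Literature.RingTheory.FormalGroups (FormalGroupHom evalNilp evalNilp₂)

namespace Literature.AlgebraicGeometry.GroupSchemes

variable {k : Type u} [CommRing k] {p H : ℕ} (B : BTGroup (Spec (.of k)) p H)
  (c : ∀ (n : ℕ) (R : Type u) [CommRing R] [Algebra k R], (specOver (A := k) R ⟶ B.G n) ≃ {x : R // x ^ (p ^ (n * H)) = 0})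
  (F : FormalGroup k) [F.IsComm]

/-! ## §1 The law read through the coordinates: unit, multiplication by `m`, `pⁿ` kills -/

section Law

variable (hlaw : ∀ (n : ℕ) (R : Type u) [CommRing R] [Algebra k R] (f g : specOver (A := k) R ⟶ B.G n),
  letI := B.grpObj n; ((c n R) (f * g)).1 = evalNilp₂ F.toPowerSeries ((c n R) f).1 ((c n R) g).1)
include hlaw

omit [F.IsComm] in
/-- **The unit section has coordinate `0`**: the point `z` with `c z = 0` satisfies `z * z = z` (`F(0,0) = 0`), so `z = 1`.
[cite: Tate1967, §2.2 (proof of Prop. 1)] -/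
theorem coord_one_eq_zero_of_law (n : ℕ) (R : Type u) [CommRing R] [Algebra k R] : letI := B.grpObj n; ((c n R) 1).1 = 0 := by
  letI := B.grpObj n
  by_cases hN : p ^ (n * H) = 0
  · -- degenerate exponent: `(c 1).1 ^ 0 = 0` forces `1 = 0` in `R`
    have h1 : (1 : R) = 0 := by simpa [hN] using ((c n R) 1).2
    exact (subsingleton_of_zero_eq_one h1.symm).elim _ _
  · obtain ⟨z, hz⟩ : ∃ z : specOver (A := k) R ⟶ B.G n, z = (c n R).symm ⟨0, zero_pow hN⟩ := ⟨_, rfl⟩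
    have hz0 : ((c n R) z).1 = 0 := by rw [hz, Equiv.apply_symm_apply]
    have hzz : z * z = z := by
      apply (c n R).injective
      apply Subtype.ext
      rw [hlaw, hz0, Literature.RingTheory.FormalGroups.evalNilp₂_zero_right F IsNilpotent.zero]
    rw [← mul_eq_left.mp hzz, hz0]

/-- **Multiplication by `m` on `B.G n` is `[m]_F` on coordinates**: `c (f ≫ [m]) = [m]_F (c f)` (`[m] = (𝟙)^m` in `End(B.G n)`,
`[m]_F` = ★ `nsmulHom F m`). [cite: Tate1967, §2.2 (proof of Prop. 1)] -/
theorem coord_comp_pow_id_eq (n : ℕ) (R : Type u) [CommRing R] [Algebra k R] (f : specOver (A := k) R ⟶ B.G n) (m : ℕ) :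
    letI := B.grpObj n;
    ((c n R) (f ≫ (𝟙 (B.G n)) ^ m)).1 = evalNilp (FormalGroupHom.nsmulHom F m).toPowerSeries ((c n R) f).1 := by
  letI := B.grpObj n
  induction m with
  | zero =>
    rw [pow_zero, MonObj.comp_one, coord_one_eq_zero_of_law B c F hlaw,
      Literature.RingTheory.FormalGroups.FormalGroupHom.evalNilp_nsmulHom_zero]
  | succ m ih =>
    rw [pow_succ, MonObj.comp_mul, Category.comp_id, hlaw, ih,
      Literature.RingTheory.FormalGroups.FormalGroupHom.evalNilp_nsmulHom_succ m ⟨_, ((c n R) f).2⟩]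

/-- `c (f ^ m) = [m]_F (c f)`. [cite: Tate1967, §2.2 (proof of Prop. 1)] -/
theorem coord_pow_eq (n : ℕ) (R : Type u) [CommRing R] [Algebra k R] (f : specOver (A := k) R ⟶ B.G n) (m : ℕ) :
    letI := B.grpObj n; ((c n R) (f ^ m)).1 = evalNilp (FormalGroupHom.nsmulHom F m).toPowerSeries ((c n R) f).1 := by
  letI := B.grpObj n
  have h : f ^ m = f ≫ (𝟙 (B.G n)) ^ m := by rw [MonObj.comp_pow, Category.comp_id]
  rw [h]
  exact coord_comp_pow_id_eq B c F hlaw n R f m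

/-- **`[pⁿ]_F` kills every level-`n` coordinate**: `[pⁿ]_F (c f) = c (f ≫ [pⁿ]) = c 1 = 0`, as `B.G n` is killed by `pⁿ`.
[cite: Tate1967, §2 (2.1)] [cite: Tate1967, §2.2 (proof of Prop. 1)] -/
theorem evalNilp_nsmulHom_coord_eq_zero (n : ℕ) (R : Type u) [CommRing R] [Algebra k R] (f : specOver (A := k) R ⟶ B.G n) :
    evalNilp (FormalGroupHom.nsmulHom F (p ^ n)).toPowerSeries ((c n R) f).1 = 0 := by
  letI := B.grpObj n
  rw [← coord_comp_pow_id_eq B c F hlaw n R f (p ^ n), B.killed n, MonObj.comp_one]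
  exact coord_one_eq_zero_of_law B c F hlaw n R

end Law

/-! ## §2 Compatibility with all transitions `i_{n,m} : B.G n ⟶ B.G m` -/

/-- **`c m (f ≫ i_{n,m}) = c n f`**: the `incl` clause iterated along `i_{n,m} = incl n ≫ ⋯ ≫ incl (m−1)` (★ `transition_succ_right`).
[cite: Tate1967, §2 (2.1)] -/
theorem coord_comp_transition_eq
    (hincl : ∀ (n : ℕ) (R : Type u) [CommRing R] [Algebra k R] (f : specOver (A := k) R ⟶ B.G n),
      ((c (n + 1) R) (f ≫ B.incl n)).1 = ((c n R) f).1)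
    {n m : ℕ} (hnm : n ≤ m) (R : Type u) [CommRing R] [Algebra k R] (f : specOver (A := k) R ⟶ B.G n) :
    ((c m R) (f ≫ B.transition hnm)).1 = ((c n R) f).1 := by
  induction m, hnm using Nat.le_induction with
  | base => rw [BTGroup.transition_self, Category.comp_id]
  | succ m hnm ih => rw [BTGroup.transition_succ_right B hnm, ← Category.assoc, hincl, ih]

/-! ## §3 Every `pⁿ`-torsion nilpotent point of `F` is a level-`n` coordinate -/

/-- `M ≤ p ^ (max n M * H)` for `p ≥ 2`, `H ≥ 1` (the layers eventually absorb any nilpotency index). [cite: Tate1967, §2.2 (proof of Prop. 1)] -/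
theorem le_pow_max_mul_of_two_le (hp : 2 ≤ p) (hH : 0 < H) (n M : ℕ) : M ≤ p ^ (max n M * H) :=
  (le_max_right n M).trans <| (Nat.lt_pow_self hp).le.trans <| Nat.pow_le_pow_right (by omega) (Nat.le_mul_of_pos_right _ hH)

/-- **Every `x ∈ F[pⁿ](R)` is a level-`n` coordinate.**  A nilpotent `x` is `c m g` for a point `g` of a deep layer `B.G m` (`m ≥ n`);
`[pⁿ]_F x = 0` reads `c (g^{pⁿ}) = 0 = c 1`, so `g^{pⁿ} = 1` and `g` factors through `i_{n,m} : B.G n ↪ B.G m` (★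
`BTGroup.existsUnique_fac_transition`: `B.G n = B.G m[pⁿ]`); the factorisation has coordinate `x`.
[cite: Tate1967, §2 (2.1)] [cite: Tate1967, §2.2 (proof of Prop. 1)] -/
theorem exists_coord_eq_of_mem_torsPts (hp : 2 ≤ p) (hH : 0 < H)
    (hlaw : ∀ (n : ℕ) (R : Type u) [CommRing R] [Algebra k R] (f g : specOver (A := k) R ⟶ B.G n),
      letI := B.grpObj n; ((c n R) (f * g)).1 = evalNilp₂ F.toPowerSeries ((c n R) f).1 ((c n R) g).1)
    (hincl : ∀ (n : ℕ) (R : Type u) [CommRing R] [Algebra k R] (f : specOver (A := k) R ⟶ B.G n),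
      ((c (n + 1) R) (f ≫ B.incl n)).1 = ((c n R) f).1)
    (n : ℕ) (R : Type u) [CommRing R] [Algebra k R] (x : R) (hx : IsNilpotent x)
    (hxt : evalNilp (FormalGroupHom.nsmulHom F (p ^ n)).toPowerSeries x = 0) :
    ∃ f : specOver (A := k) R ⟶ B.G n, ((c n R) f).1 = x := by
  obtain ⟨M, hM⟩ := hx
  -- a deep layer `m ≥ n` whose exponent absorbs the nilpotency index of `x`
  have hnm : n ≤ max n M := le_max_left n M
  have hxm : x ^ (p ^ (max n M * H)) = 0 := pow_eq_zero_of_le (le_pow_max_mul_of_two_le hp hH n M) hM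
  letI := B.grpObj (max n M)
  obtain ⟨g, hg⟩ : ∃ g : specOver (A := k) R ⟶ B.G (max n M), g = (c (max n M) R).symm ⟨x, hxm⟩ := ⟨_, rfl⟩
  have hgx : ((c (max n M) R) g).1 = x := by rw [hg, Equiv.apply_symm_apply]
  -- `[pⁿ]_F x = 0` says `g ^ (p ^ n) = 1`
  have hgp : g ^ (p ^ n) = 1 := by
    apply (c (max n M) R).injective
    apply Subtype.ext
    rw [coord_pow_eq B c F hlaw, hgx, hxt, coord_one_eq_zero_of_law B c F hlaw]
  -- so `g` factors through `B.G n = B.G (max n M)[pⁿ]`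
  obtain ⟨f, hf, -⟩ := B.existsUnique_fac_transition hnm g hgp
  exact ⟨f, by rw [← coord_comp_transition_eq B c hincl hnm R f, hf, hgx]⟩

/-- Consequently every `x ∈ F[pⁿ](R)` satisfies `x ^ (p ^ (n H)) = 0`. [cite: Tate1967, §2.2 (proof of Prop. 1)] -/
theorem pow_eq_zero_of_mem_torsPts (hp : 2 ≤ p) (hH : 0 < H)
    (hlaw : ∀ (n : ℕ) (R : Type u) [CommRing R] [Algebra k R] (f g : specOver (A := k) R ⟶ B.G n),
      letI := B.grpObj n; ((c n R) (f * g)).1 = evalNilp₂ F.toPowerSeries ((c n R) f).1 ((c n R) g).1)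
    (hincl : ∀ (n : ℕ) (R : Type u) [CommRing R] [Algebra k R] (f : specOver (A := k) R ⟶ B.G n),
      ((c (n + 1) R) (f ≫ B.incl n)).1 = ((c n R) f).1)
    (n : ℕ) (R : Type u) [CommRing R] [Algebra k R] (x : TorsPts F p n R) : x.1 ^ (p ^ (n * H)) = 0 := by
  obtain ⟨f, hf⟩ := exists_coord_eq_of_mem_torsPts B c F hp hH hlaw hincl n R x.1 x.2.1 x.2.2
  rw [← hf]
  exact ((c n R) f).2

/-! ## §4 Heads: the coordinates are comparison bijections `B ≅ F[p^∞]` -/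

/-- **THE DICTIONARY FROM COORDINATES AND A LAW READ THROUGH THEM.**  `B` a BT group over `Spec k` of height `H ≥ 1` (`p ≥ 2`) with a natural
coordinate system `c` (natural in `R`, compatible with `incl`) and `F` a commutative law with `c (f * g) = F(c f, c g)`: there are comparison
bijections `e n R : (Spec R → B.G n) ≃ F[pⁿ](R)` with ★ `IsPTorsionOfLawVia F p B e` (they carry `μ` to `F`-addition, `incl n` to the
inclusions, and are natural in `R`) and `(e f).1 = (c f).1`. [cite: Tate1967, §2.2 (Prop. 1)] [cite: Messing1972, Ch. II (3.3.18)] -/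
theorem BTGroup.exists_isPTorsionOfLawVia_of_coordinates (hp : 2 ≤ p) (hH : 0 < H)
    (hlaw : ∀ (n : ℕ) (R : Type u) [CommRing R] [Algebra k R] (f g : specOver (A := k) R ⟶ B.G n),
      letI := B.grpObj n; ((c n R) (f * g)).1 = evalNilp₂ F.toPowerSeries ((c n R) f).1 ((c n R) g).1)
    (hincl : ∀ (n : ℕ) (R : Type u) [CommRing R] [Algebra k R] (f : specOver (A := k) R ⟶ B.G n),
      ((c (n + 1) R) (f ≫ B.incl n)).1 = ((c n R) f).1)
    (hnat : ∀ (n : ℕ) (R R' : Type u) [CommRing R] [Algebra k R] [CommRing R'] [Algebra k R'] (φ : R →ₐ[k] R')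
      (g : specOver (A := k) R' ⟶ specOver (A := k) R), g.left = Spec.map (CommRingCat.ofHom φ.toRingHom) →
      ∀ f : specOver (A := k) R ⟶ B.G n, ((c n R') (g ≫ f)).1 = φ ((c n R) f).1) :
    ∃ e : ∀ (n : ℕ) (R : Type u) [CommRing R] [Algebra k R], (specOver (A := k) R ⟶ B.G n) ≃ TorsPts F p n R,
      IsPTorsionOfLawVia F p B e ∧
        ∀ (n : ℕ) (R : Type u) [CommRing R] [Algebra k R] (f : specOver (A := k) R ⟶ B.G n), ((e n R) f).1 = ((c n R) f).1 := by
  refine ⟨fun n R _ _ =>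
    ⟨fun f => ⟨((c n R) f).1, ⟨_, ((c n R) f).2⟩, evalNilp_nsmulHom_coord_eq_zero B c F hlaw n R f⟩,
     fun x => (c n R).symm ⟨x.1, pow_eq_zero_of_mem_torsPts B c F hp hH hlaw hincl n R x⟩,
     fun f => by simp only [Subtype.coe_eta, Equiv.symm_apply_apply],
     fun x => Subtype.ext (by simp only [Equiv.apply_symm_apply])⟩, ⟨?_, ?_, ?_⟩, fun n R _ _ f => rfl⟩
  · intro n R _ _ f g
    exact hlaw n R f g
  · intro n R _ _ f
    exact hincl n R f
  · intro n R R' _ _ _ _ φ g hg f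
    exact hnat n R R' φ g hg f

/-- **THE DICTIONARY WITH `𝒪`-ACTION.**  As above, with a map `β : 𝒪 → End B` read through `ρ : 𝒪 → End F` on coordinates
(`c (f ≫ β a) = (ρ a)(c f)`): the comparison bijections satisfy ★ `IsPTorsionOfOLawVia 𝒪 F ρ p B β e`.
[cite: Tate1967, §2.2 (Prop. 1)] [cite: Messing1972, Ch. II (3.3.18)] -/
theorem BTGroup.exists_isPTorsionOfOLawVia_of_coordinates (hp : 2 ≤ p) (hH : 0 < H)
    (hlaw : ∀ (n : ℕ) (R : Type u) [CommRing R] [Algebra k R] (f g : specOver (A := k) R ⟶ B.G n),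
      letI := B.grpObj n; ((c n R) (f * g)).1 = evalNilp₂ F.toPowerSeries ((c n R) f).1 ((c n R) g).1)
    (hincl : ∀ (n : ℕ) (R : Type u) [CommRing R] [Algebra k R] (f : specOver (A := k) R ⟶ B.G n),
      ((c (n + 1) R) (f ≫ B.incl n)).1 = ((c n R) f).1)
    (hnat : ∀ (n : ℕ) (R R' : Type u) [CommRing R] [Algebra k R] [CommRing R'] [Algebra k R'] (φ : R →ₐ[k] R')
      (g : specOver (A := k) R' ⟶ specOver (A := k) R), g.left = Spec.map (CommRingCat.ofHom φ.toRingHom) →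
      ∀ f : specOver (A := k) R ⟶ B.G n, ((c n R') (g ≫ f)).1 = φ ((c n R) f).1)
    {𝒪 : Type v} (ρ : 𝒪 → FormalGroupHom F F) (β : 𝒪 → BTGroup.Hom B B)
    (hact : ∀ (a : 𝒪) (n : ℕ) (R : Type u) [CommRing R] [Algebra k R] (f : specOver (A := k) R ⟶ B.G n),
      ((c n R) (f ≫ (β a).app n)).1 = evalNilp (ρ a).toPowerSeries ((c n R) f).1) :
    ∃ e : ∀ (n : ℕ) (R : Type u) [CommRing R] [Algebra k R], (specOver (A := k) R ⟶ B.G n) ≃ TorsPts F p n R,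
      IsPTorsionOfOLawVia 𝒪 F ρ p B β e ∧
        ∀ (n : ℕ) (R : Type u) [CommRing R] [Algebra k R] (f : specOver (A := k) R ⟶ B.G n), ((e n R) f).1 = ((c n R) f).1 := by
  obtain ⟨e, he, hec⟩ := B.exists_isPTorsionOfLawVia_of_coordinates c F hp hH hlaw hincl hnat
  refine ⟨e, ⟨he, fun a n R _ _ f => ?_⟩, hec⟩
  rw [hec, hec, hact]

end Literature.AlgebraicGeometry.GroupSchemes

end
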